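import Summits.NavierStokesRegularity.NavierStokesRegularity.Theorems.EfficiencyFloorFloorOfEfficiencyDecay
import Summits.NavierStokesRegularity.NavierStokesRegularity.Theorems.EfficiencyFloorBlowupEnstrophyUnbounded
import Literature.Analysis.FluidPDE.SelfSimilar
import Literature.Analysis.FluidPDE.FlatSwirlGauge
import Literature.Analysis.FluidPDE.TsaiLocalEnergyScaling
import Literature.Analysis.FluidPDE.NSViscosityRescaling
import HarnessLib

/-!
# `EfficiencyFloor.ProductionEfficiencyDecay` (stmt-NavierStokesRegularity-22866) is false as soon as ONE
# exactly discretely self-similar Leray–Hopf blow-up exists — negative lemma modulo `DssLerayHopfBlowup`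

`--supports stmt-NavierStokesRegularity-22866`, lane `--negative-modulo DssLerayHopfBlowup` (lead prover of the
line `efficiency_floor`; this file makes the route's own `why it might fail` line and the BC5 rung
`stub_dssStratumRung` of the registered skeleton precise and kernel-checked).

THE HYPOTHESIS `DssLerayHopfBlowup` (NOT constructible in the tree): some maximal smooth solution of the unforced
Navier–Stokes system on `ℝ³ × [0,T)`, Leray–Hopf from its rapidly decaying datum — exactly the objects the crux
quantifies over — is DISCRETELY SELF-SIMILAR about `(T, 0)` with some factor `c > 1`:
`c·u(T + c²s, c x) = u(T + s, x)` (the tree's `IsDiscretelySelfSimilar c (fun s x => u (T + s) x)`; these are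
verbatim the hypotheses of the skeleton's BC5 rung `stub_dssStratumRung`). Such an object is a finite-time
singularity from Schwartz-class data (¬ Clay (A)); only CONTINUOUSLY backward self-similar blow-up is excluded in
print (Nečas–Růžička–Šverák 1996, Tsai 1998), the discretely self-similar case is open.

THE THEOREM. `DssLerayHopfBlowup → ¬ ProductionEfficiencyDecay`. Proof: parabolic scaling multiplies the
enstrophy by the factor, `Z(T − τ/c²) = c · Z(T − τ)` (`lintegral_curl_sq_nsRescale`: `curl (c·v(c·)) = c² (curl v)(c·)`
and `dx ↦ c⁻³dx`), so along `τ_k = τ₀ c^{-2k}` the product `Z(T − τ_k) √τ_k` is CONSTANT (Leray's exact rate,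
log-periodically modulated). But `ProductionEfficiencyDecay` together with the landed supports
`BlowupEnstrophyUnbounded` (stmt-22867) and `FloorOfEfficiencyDecay` (stmt-22868) gives the super-Leray floor
`Z(t) √(T − t) → ∞` — contradiction at `τ_k` for `k` large. The same computation refutes the BC5 rung
(`dssStratumRung_false_of_DssLerayHopfBlowup`): the rung is therefore EQUIVALENT to the non-existence of such
blow-ups (a DSS-Liouville statement), not a cheaper special case of the crux.

HONEST FRAMING: conditional on an object nobody can construct; NOT a refutation of stmt-22866 (the item stays open),
and nothing about NS regularity is asserted either way. [folklore]
-/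

-- the problem directory repeats the summit name (`NavierStokesRegularity/NavierStokesRegularity`)
set_option linter.dupNamespace false

noncomputable section

open Set Filter MeasureTheory Topology Metric
open scoped ENNReal NNReal
open Literature.Analysis.FluidPDE

namespace Summit.NavierStokesRegularity.NavierStokesRegularity.Theorems

namespace ProductionEfficiencyDecayNegative

/-! ### The hypothesis -/

/-- **Hypothesis `DssLerayHopfBlowup` (NOT constructible in the tree; filed `--negative-modulo`).** Some maximal
smooth solution `(u,p)` of unforced Navier–Stokes on `ℝ³ × [0,T)` (`ν, T > 0`), Leray–Hopf from its rapidly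
decaying datum, is discretely self-similar about the blow-up point `(T, 0)` with a factor `c > 1`
(`c·u(T + c²s, c x) = u(T + s, x)` for all `s, x`). Verbatim the hypotheses of the BC5 rung `stub_dssStratumRung`
of the crux skeleton; an inhabitant is in particular a finite-time singularity from Schwartz data. -/
def DssLerayHopfBlowup : Prop :=
  ∃ (ν T : ℝ) (u : ℝ → EuclideanSpace ℝ (Fin 3) → EuclideanSpace ℝ (Fin 3))
    (p : ℝ → EuclideanSpace ℝ (Fin 3) → ℝ), 0 < ν ∧ 0 < T ∧
    Literature.Analysis.FluidPDE.IsMaximalSmoothSolution ν 0 u p T ∧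
    Literature.Analysis.FluidPDE.IsLerayHopfOn T ν 0 (u 0) u ∧
    Literature.Analysis.FluidPDE.HasRapidSpatialDecay (u 0) ∧
    ∃ c : ℝ, 1 < c ∧ Literature.Analysis.FluidPDE.IsDiscretelySelfSimilar c (fun s x => u (T + s) x)

/-! ### Enstrophy under the parabolic rescaling -/

/-- **Enstrophy scaling**: `∫|curl (u_c(t))|² = c ∫|curl u(c²t)|²` for the parabolic rescaling
`u_c(t,x) = c u(c²t, cx)`, `c > 0` (`curl (c·v(c·)) = c²(curl v)(c·)`, `dx ↦ c⁻³ dx`). [folklore] -/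
theorem lintegral_curl_sq_nsRescale {c : ℝ} (hc : 0 < c)
    (w : ℝ → EuclideanSpace ℝ (Fin 3) → EuclideanSpace ℝ (Fin 3)) (t : ℝ) :
    ∫⁻ x, ‖curl (nsRescale c w t) x‖ₑ ^ 2 = ENNReal.ofReal c * ∫⁻ x, ‖curl (w (c ^ 2 * t)) x‖ₑ ^ 2 := by
  have hfun : nsRescale c w t = fun y => c • w (c ^ 2 * t) (c • y) := by
    funext y; rw [nsRescale_apply]
  have hcurl : ∀ x, curl (nsRescale c w t) x = (c * c) • curl (w (c ^ 2 * t)) (c • x) := fun x => by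
    rw [hfun, curl_smul_comp_smul]
  calc ∫⁻ x, ‖curl (nsRescale c w t) x‖ₑ ^ 2
      = ∫⁻ x, ‖(c * c) • curl (w (c ^ 2 * t)) (c • x)‖ₑ ^ 2 := lintegral_congr fun x => by rw [hcurl x]
    _ = ENNReal.ofReal ((c * c) ^ 2) * ∫⁻ x, ‖curl (w (c ^ 2 * t)) (c • x)‖ₑ ^ 2 :=
        lintegral_enorm_sq_const_smul volume (c * c) (fun x => curl (w (c ^ 2 * t)) (c • x))
    _ = ENNReal.ofReal ((c * c) ^ 2) * (ENNReal.ofReal ((c ^ 3)⁻¹) * ∫⁻ y, ‖curl (w (c ^ 2 * t)) y‖ₑ ^ 2) := by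
        rw [lintegral_comp_smul_fin3 (fun y => ‖curl (w (c ^ 2 * t)) y‖ₑ ^ 2) hc]
    _ = ENNReal.ofReal c * ∫⁻ x, ‖curl (w (c ^ 2 * t)) x‖ₑ ^ 2 := by
        rw [← mul_assoc, ← ENNReal.ofReal_mul (by positivity)]
        congr 2
        field_simp

/-- **Log-periodic Leray rate of a DSS field**: if `w` is `c`-DSS (`c > 0`), then along the geometric sequence of
times `−τ₀ (c²)⁻¹^k` the enstrophy is `c^k` times its value at `−τ₀`. [folklore] -/
theorem lintegral_curl_sq_dss_iterate {c : ℝ} (hc : 0 < c)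
    {w : ℝ → EuclideanSpace ℝ (Fin 3) → EuclideanSpace ℝ (Fin 3)} (hw : IsDiscretelySelfSimilar c w)
    (τ₀ : ℝ) (k : ℕ) :
    ∫⁻ x, ‖curl (w (-τ₀ * (c ^ 2)⁻¹ ^ k)) x‖ₑ ^ 2 = ENNReal.ofReal c ^ k * ∫⁻ x, ‖curl (w (-τ₀)) x‖ₑ ^ 2 := by
  have hstep : ∀ s : ℝ, ∫⁻ x, ‖curl (w s) x‖ₑ ^ 2 = ENNReal.ofReal c * ∫⁻ x, ‖curl (w (c ^ 2 * s)) x‖ₑ ^ 2 := by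
    intro s
    have h1 : w s = nsRescale c w s := by
      unfold IsDiscretelySelfSimilar at hw
      rw [hw]
    rw [h1]
    exact lintegral_curl_sq_nsRescale hc w s
  induction k with
  | zero => simp
  | succ k ih =>
      have hc2 : c ^ 2 * (-τ₀ * (c ^ 2)⁻¹ ^ (k + 1)) = -τ₀ * (c ^ 2)⁻¹ ^ k := by
        have h : c ^ 2 * (c ^ 2)⁻¹ = 1 := mul_inv_cancel₀ (pow_ne_zero 2 hc.ne')
        calc c ^ 2 * (-τ₀ * (c ^ 2)⁻¹ ^ (k + 1)) = -τ₀ * (c ^ 2)⁻¹ ^ k * (c ^ 2 * (c ^ 2)⁻¹) := by ring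
          _ = -τ₀ * (c ^ 2)⁻¹ ^ k := by rw [h, mul_one]
      rw [hstep, hc2, ih, ← mul_assoc, pow_succ, mul_comm (ENNReal.ofReal c ^ k)]

/-! ### The super-Leray floor, per solution -/

/-- **Per-solution super-Leray floor** (the real-analysis core of the landed `FloorOfEfficiencyDecay`, stmt-22868,
run for ONE maximal solution): the every-subwindow ε-law for every `ε > 0` together with the divergence of the
enstrophy (`BlowupEnstrophyUnbounded.main`, stmt-22867, a theorem) gives `K/√(T−t) < Z(t)` eventually as `t ↑ T`,
for every `K`. [folklore] -/
theorem floor_eventually_of_window_law {ν T : ℝ} (hν : 0 < ν) (hT : 0 < T)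
    {u : ℝ → EuclideanSpace ℝ (Fin 3) → EuclideanSpace ℝ (Fin 3)} {p : ℝ → EuclideanSpace ℝ (Fin 3) → ℝ}
    (hmax : IsMaximalSmoothSolution ν 0 u p T) (hLH : IsLerayHopfOn T ν 0 (u 0) u)
    (hdec : HasRapidSpatialDecay (u 0))
    (hlaw : ∀ ε : ℝ, 0 < ε → ∃ t₁ ∈ Set.Ico 0 T, (∀ t ∈ Set.Ico t₁ T,
        0 < ∫⁻ x, ‖curl (u t) x‖ₑ ^ 2 ∧ ∫⁻ x, ‖curl (u t) x‖ₑ ^ 2 < ⊤) ∧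
        ∀ s t : ℝ, t₁ ≤ s → s ≤ t → t < T →
          ((∫⁻ x, ‖curl (u s) x‖ₑ ^ 2).toReal)⁻¹ ^ 2 - ((∫⁻ x, ‖curl (u t) x‖ₑ ^ 2).toReal)⁻¹ ^ 2 ≤
            ε * (t - s))
    (K : ℝ) : ∀ᶠ t in 𝓝[<] T, ENNReal.ofReal (K / Real.sqrt (T - t)) < ∫⁻ x, ‖curl (u t) x‖ₑ ^ 2 := by
  set ε : ℝ := 1 / (K ^ 2 + 1) with hεdef
  have hε : 0 < ε := by positivity
  obtain ⟨t₁, ht₁, hwin, hdecay⟩ := hlaw ε hε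
  set Z : ℝ → ℝ := fun t => (∫⁻ x, ‖curl (u t) x‖ₑ ^ 2).toReal with hZ
  have hU := BlowupEnstrophyUnbounded.main hν hT hmax hLH hdec
  have hunb : ∀ s < T, ∀ N : ℝ, ∃ t ∈ Ioo s T, N ≤ Z t := by
    intro s hs N
    have h1 := hU (max N 0)
    have h2 : ∀ᶠ t in 𝓝[<] T, t ∈ Ioo (max s t₁) T := Ioo_mem_nhdsLT (max_lt hs ht₁.2)
    obtain ⟨t, hNt, ht⟩ := (h1.and h2).exists
    have htI : t ∈ Ico t₁ T := ⟨(le_max_right _ _).trans ht.1.le, ht.2⟩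
    have htop : ∫⁻ x, ‖curl (u t) x‖ₑ ^ 2 ≠ ⊤ := (hwin t htI).2.ne
    refine ⟨t, ⟨(le_max_left _ _).trans_lt ht.1, ht.2⟩, ?_⟩
    have h3 : max N 0 ≤ Z t := (ENNReal.ofReal_le_iff_le_toReal htop).1 hNt
    exact (le_max_left _ _).trans h3
  have hdec' : ∀ s t : ℝ, t₁ ≤ s → s ≤ t → t < T → (Z s)⁻¹ ^ 2 - (Z t)⁻¹ ^ 2 ≤ ε * (t - s) :=
    fun s t h1 h2 h3 => hdecay s t h1 h2 h3
  have hIco : ∀ᶠ t in 𝓝[<] T, t ∈ Ico t₁ T := Ico_mem_nhdsLT ht₁.2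
  filter_upwards [hIco] with s hs
  have hpos := (hwin s hs).1
  have htop := (hwin s hs).2
  have hZs : 0 < Z s := ENNReal.toReal_pos hpos.ne' htop.ne
  have hinv := FloorOfEfficiencyDecay.inv_sq_le hε.le hdec' hunb hs
  have hfloor : K / Real.sqrt (T - s) < Z s := FloorOfEfficiencyDecay.floor_of_inv_sq_le hZs hs.2 hinv
  calc ENNReal.ofReal (K / Real.sqrt (T - s)) < ENNReal.ofReal (Z s) :=
        (ENNReal.ofReal_lt_ofReal_iff hZs).2 hfloor
    _ = ∫⁻ x, ‖curl (u s) x‖ₑ ^ 2 := ENNReal.ofReal_toReal htop.ne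

/-! ### The refutations modulo the hypothesis -/

/-- The core contradiction (pure scaling, no Navier–Stokes input): for a field `u` which is `c`-DSS about
`(T,0)` (`c > 1`), a super-Leray floor `K/√(T−t) < Z(t)` eventually for EVERY `K` is incompatible with one time
`t₁ < T` of positive finite enstrophy, because DSS keeps `Z(T − τ₀c^{-2k}) √(τ₀ c^{-2k})` constant in `k`
(`τ₀ = T − t₁`). [folklore] -/
theorem false_of_dss_of_window_law {T : ℝ}
    {u : ℝ → EuclideanSpace ℝ (Fin 3) → EuclideanSpace ℝ (Fin 3)} {c : ℝ} (hc : 1 < c)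
    (hdss : IsDiscretelySelfSimilar c (fun s x => u (T + s) x))
    (hfloor : ∀ K : ℝ, ∀ᶠ t in 𝓝[<] T,
      ENNReal.ofReal (K / Real.sqrt (T - t)) < ∫⁻ x, ‖curl (u t) x‖ₑ ^ 2)
    {t₁ : ℝ} (ht₁ : t₁ ∈ Ico 0 T)
    (hwin : 0 < ∫⁻ x, ‖curl (u t₁) x‖ₑ ^ 2 ∧ ∫⁻ x, ‖curl (u t₁) x‖ₑ ^ 2 < ⊤) : False := by
  have hc0 : 0 < c := one_pos.trans hc
  set τ₀ : ℝ := T - t₁ with hτ₀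
  have hτ₀0 : 0 < τ₀ := by rw [hτ₀]; linarith [ht₁.2]
  set q : ℝ := (c ^ 2)⁻¹ with hq
  have hq0 : 0 ≤ q := by positivity
  have hq1 : q < 1 := by
    rw [hq]
    exact inv_lt_one_of_one_lt₀ (by nlinarith)
  -- the real value of the enstrophy at `t₁`
  set z₀ : ℝ≥0∞ := ∫⁻ x, ‖curl (u t₁) x‖ₑ ^ 2 with hz₀
  set r₀ : ℝ := z₀.toReal with hr₀
  have hr₀0 : 0 < r₀ := ENNReal.toReal_pos hwin.1.ne' hwin.2.ne
  have hz₀r : z₀ = ENNReal.ofReal r₀ := (ENNReal.ofReal_toReal hwin.2.ne).symm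
  -- the DSS enstrophy along `t_k = T − τ₀ q^k`
  have hZk : ∀ k : ℕ, ∫⁻ x, ‖curl (u (T - τ₀ * q ^ k)) x‖ₑ ^ 2 = ENNReal.ofReal (c ^ k * r₀) := by
    intro k
    have h := lintegral_curl_sq_dss_iterate hc0 hdss τ₀ k
    have h1 : T + -τ₀ * (c ^ 2)⁻¹ ^ k = T - τ₀ * q ^ k := by rw [hq]; ring
    have h2 : T + -τ₀ = t₁ := by rw [hτ₀]; ring
    rw [h1, h2] at h
    rw [h, ← hz₀, hz₀r, ← ENNReal.ofReal_pow hc0.le, ← ENNReal.ofReal_mul (pow_nonneg hc0.le k)]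
  -- the times `t_k ↑ T`
  have htend : Tendsto (fun k : ℕ => T - τ₀ * q ^ k) atTop (𝓝[<] T) := by
    refine tendsto_nhdsWithin_iff.2 ⟨?_, Eventually.of_forall fun k => ?_⟩
    · have h := (tendsto_pow_atTop_nhds_zero_of_lt_one hq0 hq1).const_mul τ₀
      have h2 := h.const_sub T
      simpa using h2
    · show T - τ₀ * q ^ k < T
      have : 0 < τ₀ * q ^ k := mul_pos hτ₀0 (pow_pos (by rw [hq]; positivity) k)
      linarith
  -- the floor with `K = (r₀ + 1) √τ₀` at some `t_k`
  obtain ⟨k, hk⟩ := (htend.eventually (hfloor ((r₀ + 1) * Real.sqrt τ₀))).exists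
  rw [hZk k] at hk
  have hsq : Real.sqrt (T - (T - τ₀ * q ^ k)) = Real.sqrt τ₀ * (c ^ k)⁻¹ := by
    rw [show T - (T - τ₀ * q ^ k) = τ₀ * q ^ k by ring, Real.sqrt_mul hτ₀0.le, hq, inv_pow,
      Real.sqrt_inv, ← pow_mul, show 2 * k = k * 2 by ring, pow_mul, Real.sqrt_sq (pow_nonneg hc0.le k)]
  have hK : (r₀ + 1) * Real.sqrt τ₀ / Real.sqrt (T - (T - τ₀ * q ^ k)) = (r₀ + 1) * c ^ k := by
    rw [hsq]
    have : Real.sqrt τ₀ ≠ 0 := (Real.sqrt_pos.2 hτ₀0).ne'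
    have : c ^ k ≠ 0 := pow_ne_zero k hc0.ne'
    field_simp
  rw [hK, ENNReal.ofReal_lt_ofReal_iff (by positivity)] at hk
  nlinarith [pow_pos hc0 k]

/-- **`ProductionEfficiencyDecay` is false modulo `DssLerayHopfBlowup`.** Given a `c`-DSS maximal Leray–Hopf blow-up,
the crux's ε-law (any `ε`) plus the landed supports `BlowupEnstrophyUnbounded` (stmt-22867) and
`FloorOfEfficiencyDecay` (stmt-22868) give the super-Leray floor, contradicting the exact Leray rate forced by
discrete self-similarity. Conditional on a non-constructible object: NOT a refutation of the item. [folklore] -/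
theorem ProductionEfficiencyDecay_false_of_DssLerayHopfBlowup (hH : DssLerayHopfBlowup) :
    ¬ Summit.NavierStokesRegularity.NavierStokesRegularity.Theses.EfficiencyFloor.ProductionEfficiencyDecay := by
  intro hE
  obtain ⟨ν, T, u, p, hν, hT, hmax, hLH, hdec, c, hc, hdss⟩ := hH
  have hlaw := hE ν T hν hT u p hmax hLH hdec
  have hF := floor_eventually_of_window_law hν hT hmax hLH hdec hlaw
  obtain ⟨t₁, ht₁, hwin, -⟩ := hlaw 1 one_pos
  exact false_of_dss_of_window_law hc hdss hF ht₁ (hwin t₁ ⟨le_rfl, ht₁.2⟩)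

/-- **The BC5 rung `stub_dssStratumRung` (signature verbatim) is false modulo the same hypothesis** — so the rung
is EQUIVALENT to `¬ DssLerayHopfBlowup` (a DSS-Liouville statement), not a cheaper special case of the crux: on a
DSS solution the rung's own conclusion feeds `FloorOfEfficiencyDecay`'s real-analysis core exactly as the crux does.
[folklore] -/
theorem dssStratumRung_false_of_DssLerayHopfBlowup (hH : DssLerayHopfBlowup) :
    ¬ (∀ (ν T : ℝ), 0 < ν → 0 < T → ∀ (u : ℝ → EuclideanSpace ℝ (Fin 3) → EuclideanSpace ℝ (Fin 3)) (p : ℝ → EuclideanSpace ℝ (Fin 3) → ℝ), Literature.Analysis.FluidPDE.IsMaximalSmoothSolution ν 0 u p T → Literature.Analysis.FluidPDE.IsLerayHopfOn T ν 0 (u 0) u → Literature.Analysis.FluidPDE.HasRapidSpatialDecay (u 0) → (∃ c : ℝ, 1 < c ∧ Literature.Analysis.FluidPDE.IsDiscretelySelfSimilar c (fun s x => u (T + s) x)) → ∀ ε : ℝ, 0 < ε → ∃ t₁ ∈ Set.Ico 0 T, (∀ t ∈ Set.Ico t₁ T, 0 < ∫⁻ x, ‖Literature.Analysis.FluidPDE.curl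 (u t) x‖ₑ ^ 2 ∧ ∫⁻ x, ‖Literature.Analysis.FluidPDE.curl (u t) x‖ₑ ^ 2 < ⊤) ∧ ∀ s t : ℝ, t₁ ≤ s → s ≤ t → t < T → ((∫⁻ x, ‖Literature.Analysis.FluidPDE.curl (u s) x‖ₑ ^ 2).toReal)⁻¹ ^ 2 - ((∫⁻ x, ‖Literature.Analysis.FluidPDE.curl (u t) x‖ₑ ^ 2).toReal)⁻¹ ^ 2 ≤ ε * (t - s)) := by
  intro hR
  obtain ⟨ν, T, u, p, hν, hT, hmax, hLH, hdec, c, hc, hdss⟩ := hH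
  have hlaw := hR ν T hν hT u p hmax hLH hdec ⟨c, hc, hdss⟩
  have hF := floor_eventually_of_window_law hν hT hmax hLH hdec hlaw
  obtain ⟨t₁, ht₁, hwin, -⟩ := hlaw 1 one_pos
  exact false_of_dss_of_window_law hc hdss hF ht₁ (hwin t₁ ⟨le_rfl, ht₁.2⟩)

/-- **The BC5 rung is EXACTLY the DSS-Liouville statement**: `stub_dssStratumRung` (verbatim) holds iff no
exactly-DSS maximal Leray–Hopf blow-up from rapidly decaying data exists (`→`: the refutation above; `←`: the rung
quantifies only over such blow-ups, so it is vacuous without them). In particular the rung is not a statement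
about efficiency decay at all, and it is open exactly as DSS-blow-up exclusion is. [folklore] -/
theorem dssStratumRung_iff_not_DssLerayHopfBlowup :
    (∀ (ν T : ℝ), 0 < ν → 0 < T → ∀ (u : ℝ → EuclideanSpace ℝ (Fin 3) → EuclideanSpace ℝ (Fin 3)) (p : ℝ → EuclideanSpace ℝ (Fin 3) → ℝ), Literature.Analysis.FluidPDE.IsMaximalSmoothSolution ν 0 u p T → Literature.Analysis.FluidPDE.IsLerayHopfOn T ν 0 (u 0) u → Literature.Analysis.FluidPDE.HasRapidSpatialDecay (u 0) → (∃ c : ℝ, 1 < c ∧ Literature.Analysis.FluidPDE.IsDiscretelySelfSimilar c (fun s x => u (T + s) x)) → ∀ ε : ℝ, 0 < ε → ∃ t₁ ∈ Set.Ico 0 T, (∀ t ∈ Set.Ico t₁ T, 0 < ∫⁻ x, ‖Literature.Analysis.FluidPDE.curl (u t) x‖ₑ ^ 2 ∧ ∫⁻ x, ‖Literature.Analysis.FluidPDE.curl (u t) x‖ₑ ^ 2 < ⊤) ∧ ∀ s t : ℝ, t₁ ≤ s → s ≤ t → t < T → ((∫⁻ x, ‖Literature.Analysis.FluidPDE.curl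 (u s) x‖ₑ ^ 2).toReal)⁻¹ ^ 2 - ((∫⁻ x, ‖Literature.Analysis.FluidPDE.curl (u t) x‖ₑ ^ 2).toReal)⁻¹ ^ 2 ≤ ε * (t - s)) ↔
    ¬ DssLerayHopfBlowup := by
  constructor
  · exact fun hR hH => dssStratumRung_false_of_DssLerayHopfBlowup hH hR
  · intro hnot ν T hν hT u p hmax hLH hdec hdss ε _
    exact absurd ⟨ν, T, u, p, hν, hT, hmax, hLH, hdec, hdss⟩ hnot

end ProductionEfficiencyDecayNegative

end Summit.NavierStokesRegularity.NavierStokesRegularity.Theorems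

end
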